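import Literature.AlgebraicGeometry.Motives.JacobianDimensionProofs
import Literature.AlgebraicGeometry.Motives.AbelianVarietyFundamentalGroup
import Literature.AlgebraicGeometry.Motives.AbelianVarietyLie
import HarnessLib

/-!
# `dim J = ½ b₁(C)` from Abel–Jacobi and the theorem of the cube

Proof file of the named fact
`Literature.AlgebraicGeometry.Motives.two_mul_dim_eq_finrank_bettiCohomology` (`Motives/Jacobian`;
Milne, *Jacobian Varieties*, Prop. 2.1 with Thm. 2.5: `2 dim J = b₁(C(ℂ))`), closing the reduction
of `JacobianDimensionProofs.lean`. There the fact was reduced to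
(X) `isIso_bettiCohomology_map_abelJacobi` (`(f^P)^* : H¹(J(ℂ); ℚ) ≅ H¹(C(ℂ); ℚ)`, Abel–Jacobi;
Lange §4.1.1 / Lemma 4.4.1) and (Y) `b₁(A(ℂ)) = 2 dim A` for complex abelian varieties
(`two_mul_dim_eq_finrank_bettiCohomology_of`). The tree now PROVES (Y) from the count of torsion
points: `AbelianVariety.finrank_bettiCohomology_one_eq_of_natCard_torsionPoints`
(`Motives/AbelianVarietyFundamentalGroup`: `x ↦ xⁿ` is an `|A[n](ℂ)|`-sheeted covering of the
compact commutative group `A(ℂ)` by itself, so `|A[n](ℂ)| = n^{b₁}` by covering-space theory,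
Eckmann–Hilton and Hurewicz — Mumford, *Abelian Varieties*, §1 (3) read backwards), the count
`|A[n](ℂ)| = n^{2 dim A}` being the named fact `AbelianVariety.natCard_torsionPoints_of_isAlgClosed A ℂ`
(Mumford §6 App. 3), itself implied by `AbelianVariety.kerRank_zsmul_id A` (`deg [n]_A = n^{2g}`,
Görtz–Wedhorn II Prop. 27.186, the theorem of the cube; the tree's PROVED
`natCard_torsionPoints_of_isAlgClosed_of_kerRank`).

Hence the fact follows from two EXISTING named facts, with all glue proved:

* `two_mul_dim_eq_finrank_bettiCohomology_of_natCard_torsionPoints`: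
  (X) ∧ (∀ A, `natCard_torsionPoints_of_isAlgClosed A ℂ`) ⟹ the fact;
* `two_mul_dim_eq_finrank_bettiCohomology_of_kerRank`:
  (X) ∧ (∀ A, `kerRank_zsmul_id A`) ⟹ the fact.

Nothing is asserted here; when `isIso_bettiCohomology_map_abelJacobi` and `kerRank_zsmul_id` are
discharged, `two_mul_dim_eq_finrank_bettiCohomology_holds` is the one-line application.

## References

* J. S. Milne, *Jacobian Varieties* (1986), Prop. 2.1, Thm. 2.5. [Milne1986JacobianVarieties]
* H. Lange, *Abelian Varieties over the Complex Numbers* (2023), §4.1.1, Lemma 4.4.1.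
  [Lange2023AbelianVarietiesC]
* D. Mumford, *Abelian Varieties* (1970), §1 (3), §6 Application 3 (p. 64). [MumfordAV1970]
* U. Görtz, T. Wedhorn, *Algebraic Geometry II* (2023), Prop. 27.186–27.188. [GortzWedhorn2023]
-/

noncomputable section

namespace Literature.AlgebraicGeometry.Motives

/-- **`dim J = ½ b₁(C)` from Abel–Jacobi and the count of torsion points.** The named fact
`two_mul_dim_eq_finrank_bettiCohomology` (Milne Prop. 2.1 with Thm. 2.5) follows from
(X) `isIso_bettiCohomology_map_abelJacobi` and (T) `|A[n](ℂ)| = n^{2 dim A}` for all complex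
abelian varieties `A` and `n ≠ 0` (the named fact `AbelianVariety.natCard_torsionPoints_of_isAlgClosed A ℂ`,
Mumford §6 App. 3): (T) gives `b₁(A(ℂ)) = 2 dim A`
(`AbelianVariety.finrank_bettiCohomology_one_eq_of_natCard_torsionPoints`, Mumford §1 (3) via the
covering `x ↦ xⁿ`), and (X) at a complex point of `C` transports it to `C`
(`two_mul_dim_eq_finrank_bettiCohomology_of`). [cite: Milne1986JacobianVarieties, §2 Prop. 2.1 and Thm. 2.5] [cite: MumfordAV1970, §1 (3) and §6 Application 3] -/
theorem two_mul_dim_eq_finrank_bettiCohomology_of_natCard_torsionPoints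
    (hX : isIso_bettiCohomology_map_abelJacobi)
    (hT : ∀ A : AbelianVariety ℂ, AbelianVariety.natCard_torsionPoints_of_isAlgClosed A ℂ) :
    two_mul_dim_eq_finrank_bettiCohomology :=
  two_mul_dim_eq_finrank_bettiCohomology_of hX fun A ↦
    (A.finrank_bettiCohomology_one_eq_of_natCard_torsionPoints (hT A)).symm

/-- **`dim J = ½ b₁(C)` from Abel–Jacobi and the theorem of the cube.** The named fact
`two_mul_dim_eq_finrank_bettiCohomology` (Milne Prop. 2.1 with Thm. 2.5) follows from the two
named facts (X) `isIso_bettiCohomology_map_abelJacobi` (Abel–Jacobi; Lange §4.1.1 / Lemma 4.4.1)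
and (K) `AbelianVariety.kerRank_zsmul_id A` for complex abelian varieties (`deg [n]_A = n^{2g}`,
Görtz–Wedhorn II Prop. 27.186): (K) gives the torsion count (T) by the tree's PROVED
`natCard_torsionPoints_of_isAlgClosed_of_kerRank` (Prop. 27.188 (1)), and
`two_mul_dim_eq_finrank_bettiCohomology_of_natCard_torsionPoints` applies. [cite: Milne1986JacobianVarieties, §2 Prop. 2.1 and Thm. 2.5] [cite: GortzWedhorn2023, Prop. 27.186 and 27.188 (1)] [cite: MumfordAV1970, §1 (3)] -/
theorem two_mul_dim_eq_finrank_bettiCohomology_of_kerRank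
    (hX : isIso_bettiCohomology_map_abelJacobi)
    (hK : ∀ A : AbelianVariety ℂ, AbelianVariety.kerRank_zsmul_id A) :
    two_mul_dim_eq_finrank_bettiCohomology :=
  two_mul_dim_eq_finrank_bettiCohomology_of_natCard_torsionPoints hX fun A ↦
    AbelianVariety.natCard_torsionPoints_of_isAlgClosed_of_kerRank (A := A) ℂ (hK A)

end Literature.AlgebraicGeometry.Motives

end
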